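import Summits.ResolutionOfSingularities.ResolutionOfSingularities.Theorems.EquisingularLiftEquisingularLiftSectionKer
import Literature.AlgebraicGeometry.Resolution.Blowups
import Mathlib.AlgebraicGeometry.Morphisms.Flat
import HarnessLib

/-!
# `EquisingularLift` (stmt-ResolutionOfSingularities-15660), line `Sketch` v9 — helper for the research stub
# `stub_horizResolution_three`: SECTIONS ARE ADMISSIBLE HORIZONTAL CENTRES

[OURS · L1 W4.5b] Helper (not a registered stub) for the crux `EquisingularLift`; NOT a statement of any manuscript.

The `n = 3` research stub `stub_horizResolution_three` of the registered skeleton asks for a chain of blow-ups in regular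
`O`-FLAT centres, each missing a point of the running special fibre and lying over non-generic points of `Y` (the
inlined induction principle "HorizChain"). Every resolution strategy blows up closed points; upstairs these are blow-ups
along SECTIONS `s : Spec O → X₁` of the running `O`-scheme (Hensel lifts of closed points of the smooth locus, p162938).
This file proves the bookkeeping lemma that such a step is HorizChain-admissible:

* `horizChain_section_step` — if `(X₁, σ₁, Y₁)` satisfies HorizChain (from `(P, 𝟙, Y)`, `Y` inside the special fibre),
  `σ₁ ≫ q` is separated, `s` is a section of `σ₁ ≫ q`, `τ₁ : X₂ → X₁` is a blow-up along `ker s`, some point of the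
  special fibre of `X₁` differs from `s(s₀)`, and `σ₁ (s s₀)` is not a generic point of `Y`, then
  `(X₂, τ₁ ≫ σ₁, closure (τ₁⁻¹(Y₁ ∖ V(ker s))))` satisfies HorizChain.

Ingredients: `section_isClosedImmersion_and_isRegular_ker` (p167199: `s` is a closed immersion, `V(ker s)` is regular,
`supp (ker s) = range s`); flatness of `V(ker s) → Spec O` because `s.toImage : Spec O ≅ V(ker s)` (Mathlib, closed
immersions) makes that composite an isomorphism; the generic point `s(η)` of the centre maps to the generic fibre, hence
off `Y ⊆ P_s`.
-/

set_option linter.dupNamespace false -- mandated namespace `Summit.<Summit>.<Problem>` of this single-conjunct summit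
set_option linter.overlappingInstances false -- signatures carry `[IsDomain O] [IsDiscreteValuationRing O]`

noncomputable section

open CategoryTheory CategoryTheory.Limits AlgebraicGeometry TopologicalSpace
open Literature.AlgebraicGeometry.Resolution

namespace Summit.ResolutionOfSingularities.ResolutionOfSingularities.Cruxes.EquisingularLift.StrataSplit

/-- **Sections are admissible horizontal centres** (one HorizChain step): see the module docstring. [folklore] -/
theorem horizChain_section_step : ∀ (O : Type) [CommRing O] [IsDomain O] [IsDiscreteValuationRing O] (P : AlgebraicGeometry.Scheme.{0}) (q : P ⟶ AlgebraicGeometry.Spec (.of O)) (Y : TopologicalSpace.Closeds P) (X₁ X₂ : AlgebraicGeometry.Scheme.{0}) (σ₁ : X₁ ⟶ P) (Y₁ : Set X₁) (s : AlgebraicGeometry.Spec (.of O) ⟶ X₁) (τ₁ : X₂ ⟶ X₁) [AlgebraicGeometry.IsSeparated (CategoryTheory.CategoryStruct.comp σ₁ q)], (Y : Set P) ⊆ q ⁻¹' {IsLocalRing.closedPoint O} → CategoryTheory.CategoryStruct.comp s (CategoryTheory.CategoryStruct.comp σ₁ q) = CategoryTheory.CategoryStruct.id _ → Literature.AlgebraicGeometry.Resolution.IsBlowup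 τ₁ s.ker → (∃ x : X₁, (CategoryTheory.CategoryStruct.comp σ₁ q) x = IsLocalRing.closedPoint O ∧ x ≠ s (IsLocalRing.closedPoint O)) → ¬ IsGenericPoint (σ₁ (s (IsLocalRing.closedPoint O))) (Y : Set P) → (∀ Q : (∀ X' : AlgebraicGeometry.Scheme.{0}, (X' ⟶ P) → Set X' → Prop), Q P (CategoryTheory.CategoryStruct.id P) (Y : Set P) → (∀ (X' X'' : AlgebraicGeometry.Scheme.{0}) (σ' : X' ⟶ P) (Y' : Set X') (C : X'.IdealSheafData) (τ : X'' ⟶ X'), Q X' σ' Y' → Literature.AlgebraicGeometry.Resolution.IsBlowup τ C → Literature.AlgebraicGeometry.Resolution.Scheme.IsRegular C.subscheme → AlgebraicGeometry.Flat (CategoryTheory.CategoryStruct.comp C.subschemeι (CategoryTheory.CategoryStruct.comp σ' q)) → (∃ x : X', (CategoryTheory.CategoryStruct.comp σ' q) x = IsLocalRing.closedPoint O ∧ x ∉ (C.support : Set X')) → σ' '' (C.support : Set X') ⊆ {x : P | ¬ IsGenericPoint x (Y : Set P)} → Q X'' (CategoryTheory.CategoryStruct.comp τ σ') (closure (τ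 ⁻¹' (Y' \ (C.support : Set X'))))) → Q X₁ σ₁ Y₁) → (∀ Q : (∀ X' : AlgebraicGeometry.Scheme.{0}, (X' ⟶ P) → Set X' → Prop), Q P (CategoryTheory.CategoryStruct.id P) (Y : Set P) → (∀ (X' X'' : AlgebraicGeometry.Scheme.{0}) (σ' : X' ⟶ P) (Y' : Set X') (C : X'.IdealSheafData) (τ : X'' ⟶ X'), Q X' σ' Y' → Literature.AlgebraicGeometry.Resolution.IsBlowup τ C → Literature.AlgebraicGeometry.Resolution.Scheme.IsRegular C.subscheme → AlgebraicGeometry.Flat (CategoryTheory.CategoryStruct.comp C.subschemeι (CategoryTheory.CategoryStruct.comp σ' q)) → (∃ x : X', (CategoryTheory.CategoryStruct.comp σ' q) x = IsLocalRing.closedPoint O ∧ x ∉ (C.support : Set X')) → σ' '' (C.support : Set X') ⊆ {x : P | ¬ IsGenericPoint x (Y : Set P)} → Q X'' (CategoryTheory.CategoryStruct.comp τ σ') (closure (τ ⁻¹' (Y' \ (C.support : Set X'))))) → Q X₂ (CategoryTheory.CategoryStruct.comp τ₁ σ₁) (closure (τ₁ ⁻¹' (Y₁ \ (s.ker.support :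 Set X₁))))) := by
  intro O _ _ _ P q Y X₁ X₂ σ₁ Y₁ s τ₁ _ hY hs hτ hx hgen hH Q h0 hstep
  have hQ₁ : Q X₁ σ₁ Y₁ := hH Q h0 hstep
  obtain ⟨hci, hreg, -, hsupp⟩ :=
    section_isClosedImmersion_and_isRegular_ker O X₁ (σ₁ ≫ q) s hs
  haveI := hci
  -- flatness: `V(ker s) → Spec O` is the inverse of the isomorphism `s.toImage`
  have hflat : Flat (s.ker.subschemeι ≫ σ₁ ≫ q) := by
    have h1 : s.toImage ≫ (s.ker.subschemeι ≫ σ₁ ≫ q) = 𝟙 _ := by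
      rw [← Category.assoc, Scheme.Hom.toImage_imageι]; exact hs
    have h2 : s.ker.subschemeι ≫ σ₁ ≫ q = inv s.toImage := by
      rw [← cancel_epi s.toImage, h1, IsIso.hom_inv_id]
    rw [h2]; infer_instance
  -- a point of the special fibre off the centre
  -- `s` is a section: `q (σ₁ (s t)) = t`
  have hcomp : ∀ t, (σ₁ ≫ q) (s t) = t := fun t => by
    have := congrArg (fun f : Spec (.of O) ⟶ Spec (.of O) => f t) hs
    simpa using this
  have hx' : ∃ x : X₁, (σ₁ ≫ q) x = IsLocalRing.closedPoint O ∧ x ∉ (s.ker.support : Set X₁) := by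
    obtain ⟨x, hx, hne⟩ := hx
    refine ⟨x, hx, fun hmem => hne ?_⟩
    rw [hsupp] at hmem
    obtain ⟨t, rfl⟩ := hmem
    have ht : t = IsLocalRing.closedPoint O := (hcomp t).symm.trans hx
    rw [ht]
  -- the centre maps into the non-generic points of `Y`
  have himg : σ₁ '' (s.ker.support : Set X₁) ⊆ {x : P | ¬ IsGenericPoint x (Y : Set P)} := by
    rintro _ ⟨y, hy, rfl⟩
    rw [hsupp] at hy
    obtain ⟨t, rfl⟩ := hy
    intro hgp
    have hmem : σ₁ (s t) ∈ (Y : Set P) := hgp.mem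
    have hqt : (σ₁ ≫ q) (s t) = IsLocalRing.closedPoint O := by
      have h : q (σ₁ (s t)) ∈ ({IsLocalRing.closedPoint O} : Set (Spec (.of O))) := hY hmem
      have h' : q (σ₁ (s t)) = IsLocalRing.closedPoint O := h
      simpa using h' 
    have ht : t = IsLocalRing.closedPoint O := (hcomp t).symm.trans hqt
    subst ht
    exact hgen hgp
  exact hstep X₁ X₂ σ₁ Y₁ s.ker τ₁ hQ₁ hτ hreg hflat hx' himg

end Summit.ResolutionOfSingularities.ResolutionOfSingularities.Cruxes.EquisingularLift.StrataSplit

end
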